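import Summits.BirchSwinnertonDyer.Rank1Residual.Additive.TameBranchFullSqueezeLaw
import Summits.BirchSwinnertonDyer.Rank1Residual.Additive.TameBranchRatCharEqDefectTwo
import HarnessLib

/-!
# THE FULL SQUEEZE ON DEFECT 2 — integral image + first unit coefficient at ANY index `n` + ONE
# BSD-side inequality ⟹ `μ = 0`, `λ = n`, `Ш(E/ℚ)[p^∞] = 0`, `ℓ_p = 1`, `ord_p Reg_p` EXACT, and
# `TameBranchRatCharEqAt W p` — no parity input, no restriction on `λ_an`
# (cell `b2b-bsdres`, sub-cell additive-p2 = X3♯(G-ord)/X4♯(G-ord), gen 31; part 3)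

HONEST FRAMING (cell `b2b-bsdres`, run/shared/lean/b2b/bsd-rank1-residual/, verbatim in every
file): the goal of the cell is to DELETE the COMBINATION-SHAPED residual classes of the
Birch–Swinnerton-Dyer formula for ALL analytic-rank `≤ 1` elliptic curves over `ℚ` — "full BSD
formula for every rank `≤ 1` curve in class `C`" assembled STRICTLY from published theorems — so
that the rank-`≤ 1` remainder becomes exactly the CONSTRUCTION-SHAPED classes, which are TYPED
(missing-input `Prop`s), NOT attempted. This is not "finishing BSD". Sub-cell additive-p2: the
classes X3♯(G-ord) / X4♯(G-ord) are CONSTRUCTION-SHAPED and stay so; labels / RESIDUAL-MAP marks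
UNCHANGED; nothing is booked (`BSD(E,p)` at rank 1 still needs the branch `p`-adic Gross–Zagier; at
rank 0 it was closed on these rows by gen 12 when `p ∤ #Ш_an`). Theorems only; published inputs are
explicit binders (`hK` Kato 2004 Thm. 17.4 (3) half-eigenspace reading, `hmodD`, `hDel` = A175, `hGZK`,
`hmod`, and `LeadingTermClauses W p Dh` = Delbourgo 2002 (B) for a given datum). No definition, no
named fact, no `sorry`.

## What and why

Part 1 (`TameBranchFullSqueezeLaw`) proved the FULL squeeze per datum for a rational image `p^k·B`
with a `μ`-bound `m`; part 2 (`TameBranchMuPartDefectTwo`) proved `μ = 0` from the first unit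
coefficient of an INTEGRAL image `ι g = X` (the Kato-brick shape on defect 2). Composing (§1):

* rank 1: `ι g = X`, first unit index `n` (ANY `n`), `[T¹]X ≠ 0`, `v ≤ ord_p Reg_p(E,Dh)` and
  **`v_p([T¹]X) + 1 + 2·ord_p #tors ≤ v + ord_p ∏c_ℓ`** (census: `v_p(A′) + 2t ≤ v_h + ord_p ∏c`) ⟹
  Schneider, `μ(fE) = 0`, `λ(fE) = n`, **`#Ш(E/ℚ)[p^∞] = 1`**, **`ord_p Reg_p(E,Dh) = v`**, every
  `(u, ℓ)` of clause 3 has **`ℓ = 1`**, and **`char_Λ X = (g)`**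
  (`TameBranchMuPart.fullSqueeze_rankOne_of_iota_eq_of_firstUnit`);
* rank 0: `X(0) ≠ 0`, first unit index `n`, **`v_p(X(0)) + 2·ord_p #tors ≤ ord_p ∏c_ℓ`** ⟹ `μ = 0`,
  `λ = n`, `#Ш[p^∞] = 1`, `ℓ = 1`, `char_Λ X = (g)` (`…fullSqueeze_rankZero_of_iota_eq_of_firstUnit`).

§2 lifts both to X4♯(G-ord) ∩ `I₀*` ∩ {`ρ̄` onto}, `p ≥ 5`, with Kato's brick and part 4's tuple step:
**`TameBranchRatCharEqAt W p`** (cc-typer-2's typed rational main conjecture) + `#Ш[p^∞] = 1` + the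
exact regulator valuation, from Kato 17.4 (3) + (A)(B) + GZK (+ modularity at rank 0) + the finite data —
the READING of the census identity `v_p(A′) = v_p(h) + v_p(Ш_an∏c/#tors²)` (X4-2: 429/429 rows, all
with `Ш_an = 1`): on every such row the full-squeeze inequality holds with `v = v_p(h)`, so GIVEN the
identification of the engine height with Delbourgo's `Reg_p(E, ⟨,⟩_{p,ℚ})` up to a unit (the open
comparison, RESIDUAL-MAP O7-ord) the main conjecture at the pair, `Ш[p^∞] = 0` and `ℓ_p = 1` follow
at ALL of them, whatever `λ_an`. Nothing booked; labels UNCHANGED.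

References: Kato 2004 Thm. 17.4 (3) [Kato2004Asterisque]; Delbourgo 2002 Thm. (A), (B) p. 40
[Delbourgo2002]; Greenberg LNM 1716 §4 pp. 102–110 [GreenbergLNM1716]; Greenberg–Vatsal 2000 p. 4
[GreenbergVatsal2000]; Washington GTM 83 §7.1 [Washington1997]; parts 1, 2, 4 of gen 31. -/

set_option autoImplicit false

noncomputable section

open scoped Classical MatrixGroups ModularForm NumberField

open CongruenceSubgroup IsDedekindDomain WeierstrassCurve NumberField
  Literature.NumberTheory.EllipticCurves
  Literature.NumberTheory.EllipticCurves.ModularForms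
  Literature.NumberTheory.EllipticCurves.Rank1Residual
  Literature.NumberTheory.EllipticCurves.Rank1Residual.Typed
  Literature.NumberTheory.EllipticCurves.Delbourgo2002
  Literature.NumberTheory.GaloisRepresentations
  Summit.BirchSwinnertonDyer.Rank1Residual.AdditivePotMult
  Summit.BirchSwinnertonDyer.Rank1Residual.X1.MuLambda
  Summit.BirchSwinnertonDyer.Rank1Residual.X1.RankOneParitySqueeze
  Summit.BirchSwinnertonDyer.Rank1Residual.X11a.LambdaNorm

namespace Summit.BirchSwinnertonDyer.Rank1Residual.Additive

/-! ### §1 Per datum: the full squeeze on the integral shape -/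

namespace TameBranchMuPart

open TameBranchExtraZeros TameBranchLambdaParity TameBranchFullSqueeze

variable {W : WeierstrassCurve ℚ} [W.IsElliptic] {p : ℕ} [hp : Fact p.Prime]

/-- **THE FULL SQUEEZE AT RANK ONE ON THE INTEGRAL SHAPE (per datum; no parity input).** `p ≠ 2`,
`rank_ℤ E(ℚ) = 1`, a (B)-datum `Dh`, a cyclotomic dual datum with `X` torsion and generator `fE`,
`g ∈ char_Λ X` with `ι g = X` INTEGRAL (defect 2: `X = u·ϖ·B^±_{(p−1)/2}`), first unit coefficient at `n`,
`[T¹]X ≠ 0`, and `v ≤ ord_p Reg_p(E,Dh)` with **`v_p([T¹]X) + 1 + 2·ord_p #E(ℚ)_tors ≤ v + ord_p ∏c_ℓ`**.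
Then Schneider, **`μ(fE) = 0`**, **`λ(fE) = n`**, **`#Ш(E/ℚ)[p^∞] = 1`**, **`ord_p Reg_p(E,Dh) = v`**, every
`(u, ℓ)` fitting clause 3 of (B) has **`ℓ = 1`**, and **`char_Λ X = (g)`**.
[cite: Delbourgo2002, Theorem (B) (p. 40)] [cite: GreenbergLNM1716, §4 pp. 102–110] [cite: Washington1997, §7.1] -/
theorem fullSqueeze_rankOne_of_iota_eq_of_firstUnit (hp2 : p ≠ 2)
    (hr1 : W.mordellWeilRank = 1) {Dh : PAdicHeightData W p} (hBcl : LeadingTermClauses W p Dh)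
    {κ : ZpExtension ℚ p} {γ : Field.absoluteGaloisGroup ℚ}
    (hκ : κ.IsCyclotomic) (hγ : κ.IsTopGenerator γ) (hγ' : IsCyclotomicVariable p γ)
    (D : W.SelmerDualData κ γ) [Module.Finite (IwasawaAlgebra p) D.X] (hX : D.IsTorsion)
    {fE g : IwasawaAlgebra p} (hchar : D.charIdeal = Ideal.span {fE}) (hg : g ∈ D.charIdeal)
    {X : PowerSeries ℚ_[p]} (hι : iwasawaToPowerSeries p g = X)
    {n : ℕ} (hn : ‖PowerSeries.coeff n X‖ = 1) (hlt : ∀ i < n, ‖PowerSeries.coeff i X‖ < 1)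
    (hX1 : PowerSeries.coeff 1 X ≠ 0) {v : ℤ} (hv : v ≤ (padicRegulator Dh).valuation)
    (hfull : (PowerSeries.coeff 1 X).valuation + 1 + 2 * padicValNat p W.torsionOrder ≤
      v + padicValNat p W.tamagawaProduct) :
    SchneiderConjecture Dh ∧ mu fE = 0 ∧ lam fE = n ∧
      Nat.card (AddCommGroup.primaryComponent W.sha p) = 1 ∧ (padicRegulator Dh).valuation = v ∧
      (∀ (u : ℤ_[p]ˣ) (ℓ : ℕ), ℓ ∣ p ^ 2 →
        ((PowerSeries.coeff W.mordellWeilRank fE : ℤ_[p]) : ℚ_[p]) *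
            padicLog p (cyclotomicGenerator p) ^ W.mordellWeilRank * (W.torsionOrder : ℚ_[p]) ^ 2 =
          ((u : ℤ_[p]) : ℚ_[p]) * (ℓ : ℚ_[p]) *
            ((Nat.card (AddCommGroup.primaryComponent W.sha p) : ℚ_[p]) *
              padicRegulator Dh * W.tamagawaProduct) → ℓ = 1) ∧
      D.charIdeal = Ideal.span {g} := by
  have hdvd : fE ∣ g := by
    have hg' := hg
    rw [hchar] at hg'
    exact Ideal.mem_span_singleton.mp hg'
  obtain ⟨-, hμ, -⟩ := mu_eq_zero_and_lam_le_of_dvd_of_firstUnit hdvd hι hn hlt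
  have hn' : ‖PowerSeries.coeff n X‖ = (p : ℝ) ^ (0 : ℕ) := by rw [pow_zero]; exact hn
  have hlt' : ∀ i < n, ‖PowerSeries.coeff i X‖ < (p : ℝ) ^ (0 : ℕ) := fun i hi ↦ by
    rw [pow_zero]; exact hlt i hi
  obtain ⟨hS, hlam, -, hcard, hReg, -, hℓ, G, hG, -, -, hιG⟩ :=
    fullSqueeze_rankOne_of_iota_eq_of_firstTop hp2 hr1 hBcl hκ hγ hγ' D hX hchar hg
      (iota_eq_C_pow_zero_mul hι) (norm_coeff_le_pow_zero_of_iota_eq hι) hn' hlt' hX1 (m := 0) hμ.le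
      hv (by simp only [Nat.cast_zero, zero_add, add_zero]; exact hfull)
  rw [add_zero, pow_zero, map_one, one_mul, ← hι] at hιG
  exact ⟨hS, hμ, hlam, hcard, hReg, hℓ, by rw [hG, iwasawaToPowerSeries_injective p hιG]⟩

/-- **THE FULL SQUEEZE AT RANK ZERO ON THE INTEGRAL SHAPE (per datum).** `rank_ℤ E(ℚ) = 0`, a
(B)-datum, `ι g = X` integral with first unit coefficient at `n`, `X(0) ≠ 0`, and
**`v_p(X(0)) + 2·ord_p #E(ℚ)_tors ≤ ord_p ∏c_ℓ`**. Then **`μ(fE) = 0`**, **`λ(fE) = n`**,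
**`#Ш(E/ℚ)[p^∞] = 1`**, every `(u, ℓ)` of clause 3 has **`ℓ = 1`**, and **`char_Λ X = (g)`**.
[cite: Delbourgo2002, Theorem (B) (p. 40)] [cite: GreenbergLNM1716, §4 pp. 102–110] [cite: Washington1997, §7.1] -/
theorem fullSqueeze_rankZero_of_iota_eq_of_firstUnit (hp2 : p ≠ 2)
    (hr0 : W.mordellWeilRank = 0) {Dh : PAdicHeightData W p} (hBcl : LeadingTermClauses W p Dh)
    {κ : ZpExtension ℚ p} {γ : Field.absoluteGaloisGroup ℚ}
    (hκ : κ.IsCyclotomic) (hγ : κ.IsTopGenerator γ) (hγ' : IsCyclotomicVariable p γ)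
    (D : W.SelmerDualData κ γ) [Module.Finite (IwasawaAlgebra p) D.X] (hX : D.IsTorsion)
    {fE g : IwasawaAlgebra p} (hchar : D.charIdeal = Ideal.span {fE}) (hg : g ∈ D.charIdeal)
    {X : PowerSeries ℚ_[p]} (hι : iwasawaToPowerSeries p g = X)
    {n : ℕ} (hn : ‖PowerSeries.coeff n X‖ = 1) (hlt : ∀ i < n, ‖PowerSeries.coeff i X‖ < 1)
    (hX0 : PowerSeries.constantCoeff X ≠ 0)
    (hfull : (PowerSeries.constantCoeff X).valuation + 2 * padicValNat p W.torsionOrder ≤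
      padicValNat p W.tamagawaProduct) :
    mu fE = 0 ∧ lam fE = n ∧ Nat.card (AddCommGroup.primaryComponent W.sha p) = 1 ∧
      (∀ (u : ℤ_[p]ˣ) (ℓ : ℕ), ℓ ∣ p ^ 2 →
        ((PowerSeries.coeff W.mordellWeilRank fE : ℤ_[p]) : ℚ_[p]) *
            padicLog p (cyclotomicGenerator p) ^ W.mordellWeilRank * (W.torsionOrder : ℚ_[p]) ^ 2 =
          ((u : ℤ_[p]) : ℚ_[p]) * (ℓ : ℚ_[p]) *
            ((Nat.card (AddCommGroup.primaryComponent W.sha p) : ℚ_[p]) *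
              padicRegulator Dh * W.tamagawaProduct) → ℓ = 1) ∧
      D.charIdeal = Ideal.span {g} := by
  have hdvd : fE ∣ g := by
    have hg' := hg
    rw [hchar] at hg'
    exact Ideal.mem_span_singleton.mp hg'
  obtain ⟨-, hμ, -⟩ := mu_eq_zero_and_lam_le_of_dvd_of_firstUnit hdvd hι hn hlt
  have hn' : ‖PowerSeries.coeff n X‖ = (p : ℝ) ^ (0 : ℕ) := by rw [pow_zero]; exact hn
  have hlt' : ∀ i < n, ‖PowerSeries.coeff i X‖ < (p : ℝ) ^ (0 : ℕ) := fun i hi ↦ by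
    rw [pow_zero]; exact hlt i hi
  obtain ⟨hlam, -, hcard, -, hℓ, G, hG, -, -, hιG⟩ :=
    fullSqueeze_rankZero_of_iota_eq_of_firstTop hp2 hr0 hBcl hκ hγ hγ' D hX hchar hg
      (iota_eq_C_pow_zero_mul hι) (norm_coeff_le_pow_zero_of_iota_eq hι) hn' hlt' hX0 (m := 0) hμ.le
      (by simp only [Nat.cast_zero, zero_add, add_zero]; exact hfull)
  rw [add_zero, pow_zero, map_one, one_mul, ← hι] at hιG
  exact ⟨hμ, hlam, hcard, hℓ, by rw [hG, iwasawaToPowerSeries_injective p hιG]⟩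

end TameBranchMuPart

/-! ### §2 X4♯(G-ord) ∩ `I₀*` ∩ {`ρ̄` onto}, `p ≥ 5`: the full-squeeze route to `TameBranchRatCharEqAt` -/

section ClassLevel

open TameBranchMuPart

variable {W : WeierstrassCurve ℚ} [W.IsElliptic] [W.IsGloballyMinimal] {p : ℕ} [hp : Fact p.Prime]

omit [W.IsElliptic] [W.IsGloballyMinimal] hp in
/-- `v_p(u·x) = v_p(x)` for `u ∈ ℤ_p^×` (coefficients of `C(u·ϖ)·B` vs `C(ϖ)·B`). [folklore] -/
theorem valuation_coeff_C_unit_mul [Fact p.Prime] (u : ℤ_[p]ˣ) (ϖ : ℚ_[p]) (B : PowerSeries ℚ_[p])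
    (j : ℕ) (h : PowerSeries.coeff j (PowerSeries.C ϖ * B) ≠ 0) :
    (PowerSeries.coeff j (PowerSeries.C (((u : ℤ_[p]) : ℚ_[p]) * ϖ) * B)).valuation =
      (PowerSeries.coeff j (PowerSeries.C ϖ * B)).valuation := by
  rw [PowerSeries.coeff_C_mul] at h ⊢
  rw [PowerSeries.coeff_C_mul, mul_assoc, Padic.valuation_mul (coe_units_ne_zero p u) h,
    valuation_coe_units_eq_zero, zero_add]

/-- **HEADLINE, RANK ONE, FULL ROUTE (any `λ_an`).** X4♯(G-ord) ∩ `I₀*` ∩ {`ρ̄` onto}, `p ≥ 5`,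
`ord_{s=1} L(E,s) = 1`, a (B)-datum `Dh`; data: the first unit coefficient of `ϖ·B^±_{(p−1)/2}(f♭, α)` at
SOME index `n` with `[T¹] ≠ 0`, one non-zero plus symbol of `E`'s newform, and a certified
`v ≤ ord_p Reg_p(E,Dh)` with **`v_p([T¹](ϖ·B^±)) + 1 + 2·ord_p #tors ≤ v + ord_p ∏c_ℓ`** (census:
`v_p(A′) + 2t ≤ v_h + ord_p ∏c`, an EQUALITY on 429/429 defect-2 window rows). Then
**`TameBranchRatCharEqAt W p`**, Schneider, **`ord_p Reg_p(E,Dh) = v`**, **`#Ш(E/ℚ)[p^∞] = 1`**, and every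
generator of `char_Λ X(E/ℚ_∞)` has `μ = 0`, `λ = n`. Inputs: Kato 17.4 (3), (B), GZK — NO parity.
[cite: Kato2004Asterisque, Thm. 17.4 (3) (p. 273)] [cite: Delbourgo2002, Theorem (B) (p. 40)]
[cite: GreenbergLNM1716, §4 pp. 102–110] [cite: MazurTateTeitelbaum1986Invent, §I.13–I.14] -/
theorem ClassX4Gord.tameBranchRatCharEqAt_of_katoHalf_of_fullSqueeze_rankOne
    (hK : Wuthrich2014.kato_halfEigenCharIdeal_dvd_cyclotomicPrime_of_surjective)
    (hmodD : nonempty_modularParametrizationData)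
    (hGZK : rank_eq_analyticRank_of_analyticRank_le_one)
    (hX : ClassX4Gord W p) (hp5 : 5 ≤ p) (he : semistabilityIndex W p = 2) (hsurj : Surj W p)
    (hr : W.analyticRank = 1) {Dh : PAdicHeightData W p} (hBcl : LeadingTermClauses W p Dh)
    (hnd : ∀ {N : ℕ} [NeZero N] (f : CuspForm (Gamma0 N) 2), IsNewformOf W f →
      ∃ s : ℚ, ratPlusSymbol f s ≠ 0) {n : ℕ} {v : ℤ} (hv : v ≤ (padicRegulator Dh).valuation)
    (hcert : ∀ (V : WeierstrassCurve ℚ) [V.IsElliptic] [V.IsGloballyMinimal] (C : VariableChange ℚ),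
      C • V.quadraticTwist ((-1 : ℚ) ^ (p / 2) * p) = W → IsOrdinaryAt V p →
      ∀ {N : ℕ} [NeZero N] (f : CuspForm (Gamma0 N) 2), IsNewformOf V f →
      ∀ ϖ : ℚ, (if Even (p / 2) then (ϖ : ℝ) * V.realPeriodRat = plusPeriod f
          else (ϖ : ℝ) * V.imaginaryPeriodRat = minusPeriod f) →
        PowerSeries.coeff 1 (PowerSeries.C (ϖ : ℚ_[p]) *
            (if Even (p / 2) then padicLFunctionBranch f ((unitRoot V p : ℤ_[p]) : ℚ_[p]) (p / 2)
              else padicLFunctionMinusBranch f ((unitRoot V p : ℤ_[p]) : ℚ_[p]) (p / 2))) ≠ 0 ∧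
        (PowerSeries.coeff 1 (PowerSeries.C (ϖ : ℚ_[p]) *
            (if Even (p / 2) then padicLFunctionBranch f ((unitRoot V p : ℤ_[p]) : ℚ_[p]) (p / 2)
              else padicLFunctionMinusBranch f ((unitRoot V p : ℤ_[p]) : ℚ_[p]) (p / 2)))).valuation +
            1 + 2 * padicValNat p W.torsionOrder ≤ v + padicValNat p W.tamagawaProduct ∧
        ‖PowerSeries.coeff n (PowerSeries.C (ϖ : ℚ_[p]) *
            (if Even (p / 2) then padicLFunctionBranch f ((unitRoot V p : ℤ_[p]) : ℚ_[p]) (p / 2)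
              else padicLFunctionMinusBranch f ((unitRoot V p : ℤ_[p]) : ℚ_[p]) (p / 2)))‖ = 1 ∧
        ∀ i < n, ‖PowerSeries.coeff i (PowerSeries.C (ϖ : ℚ_[p]) *
            (if Even (p / 2) then padicLFunctionBranch f ((unitRoot V p : ℤ_[p]) : ℚ_[p]) (p / 2)
              else padicLFunctionMinusBranch f ((unitRoot V p : ℤ_[p]) : ℚ_[p]) (p / 2)))‖ < 1) :
    TameBranchRatCharEqAt W p ∧ SchneiderConjecture Dh ∧ (padicRegulator Dh).valuation = v ∧
      Nat.card (AddCommGroup.primaryComponent W.sha p) = 1 ∧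
      ∀ (κ : ZpExtension ℚ p) (γ : Field.absoluteGaloisGroup ℚ),
        κ.IsCyclotomic → κ.IsTopGenerator γ → IsCyclotomicVariable p γ →
        ∀ (D : W.SelmerDualData κ γ) (fE : IwasawaAlgebra p), D.charIdeal = Ideal.span {fE} →
          mu fE = 0 ∧ lam fE = n := by
  have hp2 : p ≠ 2 := by omega
  obtain ⟨hmw, -⟩ := hGZK W (by rw [hr])
  have hr1 : W.mordellWeilRank = 1 := by rw [hmw, hr]
  obtain ⟨V, iV, iVm, C, hV, hC⟩ := hX.exists_goodOrd_pStar_twist_model W p he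
  haveI : NeZero (V.conductorNorm ℤ) := ⟨(V.conductorNorm_pos_holds).ne'⟩
  obtain ⟨Dm⟩ := hmodD V
  obtain ⟨ϖ, hϖ⟩ := exists_periodRatio_parity (p := p) V Dm
  have hj := padicValRat_j_nonneg_of_typeGOrd W p hX.typeGOrd
  have hsurjV : ∀ m : ℕ, V.HasSurjectiveModNGaloisRep (p ^ m : ℕ) :=
    X4RankZeroTwistOdd.forall_surj_pow_twist_of_surj W p hp5 V (pStar_ne_zero p) C hC hsurj
  have hord : IsOrdinaryAt V p :=
    isOrdinaryAt_of_goodOrd_or_mult_of_model_twist W V (pStar_ne_zero p) ⟨C, hC⟩ hj (Or.inl hV)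
  obtain ⟨h1, hfull, hn, hlt⟩ := hcert V C hC hord Dm.f Dm.isNewformOf ϖ hϖ
  have hϖ0 : ϖ ≠ 0 := by
    rintro rfl
    apply h1
    rw [Rat.cast_zero, map_zero, zero_mul, map_zero]
  have hB0 : (if Even (p / 2) then padicLFunctionBranch Dm.f ((unitRoot V p : ℤ_[p]) : ℚ_[p]) (p / 2)
      else padicLFunctionMinusBranch Dm.f ((unitRoot V p : ℤ_[p]) : ℚ_[p]) (p / 2)) ≠ 0 := by
    intro e; apply h1; rw [e, mul_zero, map_zero]
  -- one cyclotomic datum exists: the datum-independent conclusions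
  obtain ⟨κ₀, γ₀, hκ₀, hγ₀, hγ₀', D₀, fE₀, hchar₀⟩ := exists_cyclotomic_dualData_generator W p
  have key : ∀ (κ : ZpExtension ℚ p) (γ : Field.absoluteGaloisGroup ℚ),
      κ.IsCyclotomic → κ.IsTopGenerator γ → IsCyclotomicVariable p γ →
      ∀ (D : W.SelmerDualData κ γ) (fE : IwasawaAlgebra p), D.charIdeal = Ideal.span {fE} →
        D.IsTorsion ∧ SchneiderConjecture Dh ∧ mu fE = 0 ∧ lam fE = n ∧
          Nat.card (AddCommGroup.primaryComponent W.sha p) = 1 ∧ (padicRegulator Dh).valuation = v ∧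
          ∃ (g₁ : IwasawaAlgebra p) (u : ℤ_[p]ˣ),
          D.charIdeal = Ideal.span {g₁} ∧ iwasawaToPowerSeries p g₁ =
            PowerSeries.C (((u : ℤ_[p]) : ℚ_[p]) * (ϖ : ℚ_[p])) *
              (if Even (p / 2) then padicLFunctionBranch Dm.f ((unitRoot V p : ℤ_[p]) : ℚ_[p]) (p / 2)
                else padicLFunctionMinusBranch Dm.f ((unitRoot V p : ℤ_[p]) : ℚ_[p]) (p / 2)) := by
    intro κ γ hκ hγ hγ' D fE hchar
    haveI : Module.Finite (IwasawaAlgebra p) D.X :=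
      SelmerDualData.module_finite_of_isCyclotomic (W := W) (κ := κ) hκ D hγ
    obtain ⟨hXt, g, hg, u, hι⟩ := isTorsion_and_exists_iota_eq_branch_of_katoComponent W p
      (Kato2004.charIdeal_dvd_padicLFunctionBranch_component_of_surjective_of_half hK) hj hp2 V
      ⟨C, hC⟩ (Or.inl hV) hsurjV hκ hγ hγ' Dm.isNewformOf D ϖ hϖ
    have hn' := hn
    rw [← norm_coeff_C_unit_mul u] at hn'
    have hX1 : PowerSeries.coeff 1 (PowerSeries.C (((u : ℤ_[p]) : ℚ_[p]) * (ϖ : ℚ_[p])) *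
        (if Even (p / 2) then padicLFunctionBranch Dm.f ((unitRoot V p : ℤ_[p]) : ℚ_[p]) (p / 2)
          else padicLFunctionMinusBranch Dm.f ((unitRoot V p : ℤ_[p]) : ℚ_[p]) (p / 2))) ≠ 0 := by
      rw [PowerSeries.coeff_C_mul, mul_assoc]
      rw [PowerSeries.coeff_C_mul] at h1
      exact mul_ne_zero (PadicInt.coe_ne_zero.mpr u.ne_zero) h1
    have hfull' := hfull
    rw [← valuation_coeff_C_unit_mul u _ _ 1 h1] at hfull'
    obtain ⟨hS, hμ, hlam, hcard, hReg, -, hspan⟩ := fullSqueeze_rankOne_of_iota_eq_of_firstUnit hp2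
      hr1 hBcl hκ hγ hγ' D hXt hchar hg hι hn'
      (fun i hi ↦ by rw [norm_coeff_C_unit_mul u]; exact hlt i hi) hX1 hv hfull'
    exact ⟨hXt, hS, hμ, hlam, hcard, hReg, g, u, hspan, hι⟩
  obtain ⟨-, hS₀, -, -, hcard₀, hReg₀, -⟩ := key κ₀ γ₀ hκ₀ hγ₀ hγ₀' D₀ fE₀ hchar₀
  refine ⟨?_, hS₀, hReg₀, hcard₀, fun κ γ hκ hγ hγ' D fE hchar ↦
    ⟨(key κ γ hκ hγ hγ' D fE hchar).2.2.1, (key κ γ hκ hγ hγ' D fE hchar).2.2.2.1⟩⟩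
  intro κ γ N _ f ε α B _ haddv _ hκ hγ hcv hf _ hα hB D
  haveI : (Literature.NumberTheory.EllipticCurves.Module.charIdeal (IwasawaAlgebra p) D.X).IsPrincipal :=
    charIdeal_isPrincipal_holds p D.X
  obtain ⟨fE, hchar⟩ := Submodule.IsPrincipal.principal
    (Literature.NumberTheory.EllipticCurves.Module.charIdeal (IwasawaAlgebra p) D.X)
  obtain ⟨hXt, -, -, -, -, -, g₁, u, hspan, hι⟩ := key κ γ hκ hγ hcv D fE hchar
  exact ⟨hXt, exists_charIdeal_eq_span_and_iota_eq_of_generator hp2 V C hC haddv hV hf (hnd f hf) Dm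
    hϖ0 hspan hι hB0 hα hB⟩

/-- **HEADLINE, RANK ZERO, FULL ROUTE (any `λ_an`).** X4♯(G-ord) ∩ `I₀*` ∩ {`ρ̄` onto}, `p ≥ 5`, `E`
non-CM, `ord_{s=1} L(E,s) = 0`; data: the first unit coefficient of `ϖ·B^±` at SOME index `n`,
`ϖ·B^±(0) ≠ 0` with **`v_p(ϖ·B^±(0)) + 2·ord_p #tors ≤ ord_p ∏c_ℓ`**. Then **`TameBranchRatCharEqAt W p`**,
**`#Ш(E/ℚ)[p^∞] = 1`**, and every generator of `char_Λ X(E/ℚ_∞)` has `μ = 0`, `λ = n`. Inputs: Kato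
17.4 (3), A175, GZK, modularity — NO parity. [cite: Kato2004Asterisque, Thm. 17.4 (3) (p. 273)]
[cite: Delbourgo2002, Theorem (A), (B) (p. 40)] [cite: GreenbergLNM1716, §4 pp. 102–110]
[cite: MazurTateTeitelbaum1986Invent, §I.13–I.14] -/
theorem ClassX4Gord.tameBranchRatCharEqAt_of_katoHalf_of_fullSqueeze_rankZero
    (hK : Wuthrich2014.kato_halfEigenCharIdeal_dvd_cyclotomicPrime_of_surjective)
    (hmodD : nonempty_modularParametrizationData) (hDel : Delbourgo2002.mainTheorem)
    (hGZK : rank_eq_analyticRank_of_analyticRank_le_one) (hmod : hasEntireLFunction_rat)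
    (hX : ClassX4Gord W p) (hp5 : 5 ≤ p) (hcm : ¬ W.HasCM) (he : semistabilityIndex W p = 2)
    (hsurj : Surj W p) (hr : W.analyticRank = 0) {n : ℕ}
    (hcert : ∀ (V : WeierstrassCurve ℚ) [V.IsElliptic] [V.IsGloballyMinimal] (C : VariableChange ℚ),
      C • V.quadraticTwist ((-1 : ℚ) ^ (p / 2) * p) = W → IsOrdinaryAt V p →
      ∀ {N : ℕ} [NeZero N] (f : CuspForm (Gamma0 N) 2), IsNewformOf V f →
      ∀ ϖ : ℚ, (if Even (p / 2) then (ϖ : ℝ) * V.realPeriodRat = plusPeriod f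
          else (ϖ : ℝ) * V.imaginaryPeriodRat = minusPeriod f) →
        PowerSeries.constantCoeff (PowerSeries.C (ϖ : ℚ_[p]) *
            (if Even (p / 2) then padicLFunctionBranch f ((unitRoot V p : ℤ_[p]) : ℚ_[p]) (p / 2)
              else padicLFunctionMinusBranch f ((unitRoot V p : ℤ_[p]) : ℚ_[p]) (p / 2))) ≠ 0 ∧
        (PowerSeries.constantCoeff (PowerSeries.C (ϖ : ℚ_[p]) *
            (if Even (p / 2) then padicLFunctionBranch f ((unitRoot V p : ℤ_[p]) : ℚ_[p]) (p / 2)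
              else padicLFunctionMinusBranch f ((unitRoot V p : ℤ_[p]) : ℚ_[p]) (p / 2)))).valuation +
            2 * padicValNat p W.torsionOrder ≤ padicValNat p W.tamagawaProduct ∧
        ‖PowerSeries.coeff n (PowerSeries.C (ϖ : ℚ_[p]) *
            (if Even (p / 2) then padicLFunctionBranch f ((unitRoot V p : ℤ_[p]) : ℚ_[p]) (p / 2)
              else padicLFunctionMinusBranch f ((unitRoot V p : ℤ_[p]) : ℚ_[p]) (p / 2)))‖ = 1 ∧
        ∀ i < n, ‖PowerSeries.coeff i (PowerSeries.C (ϖ : ℚ_[p]) *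
            (if Even (p / 2) then padicLFunctionBranch f ((unitRoot V p : ℤ_[p]) : ℚ_[p]) (p / 2)
              else padicLFunctionMinusBranch f ((unitRoot V p : ℤ_[p]) : ℚ_[p]) (p / 2)))‖ < 1) :
    TameBranchRatCharEqAt W p ∧ Nat.card (AddCommGroup.primaryComponent W.sha p) = 1 ∧
      ∀ (κ : ZpExtension ℚ p) (γ : Field.absoluteGaloisGroup ℚ),
        κ.IsCyclotomic → κ.IsTopGenerator γ → IsCyclotomicVariable p γ →
        ∀ (D : W.SelmerDualData κ γ) (fE : IwasawaAlgebra p), D.charIdeal = Ideal.span {fE} →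
          mu fE = 0 ∧ lam fE = n := by
  have hp2 : p ≠ 2 := by omega
  have hadd : ¬ W.HasGoodReductionAtPrime p ∧ ¬ W.HasMultiplicativeReductionAtPrime p := hX.addv.2
  obtain ⟨hmw, -⟩ := hGZK W (by rw [hr]; norm_num)
  have hr0 : W.mordellWeilRank = 0 := by rw [hmw, hr]
  have hL : W.entireLFunction 1 ≠ 0 := (W.analyticRank_eq_zero_iff_holds (hmod W)).mp hr
  obtain ⟨Dh, hBcl⟩ := Delbourgo2002.mainTheorem.exists_leadingTermClauses hDel hp5 hcm hadd hX.typeGOrd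
  obtain ⟨V, iV, iVm, C, hV, hC⟩ := hX.exists_goodOrd_pStar_twist_model W p he
  haveI : NeZero (V.conductorNorm ℤ) := ⟨(V.conductorNorm_pos_holds).ne'⟩
  obtain ⟨Dm⟩ := hmodD V
  obtain ⟨ϖ, hϖ⟩ := exists_periodRatio_parity (p := p) V Dm
  have hj := padicValRat_j_nonneg_of_typeGOrd W p hX.typeGOrd
  have hsurjV : ∀ m : ℕ, V.HasSurjectiveModNGaloisRep (p ^ m : ℕ) :=
    X4RankZeroTwistOdd.forall_surj_pow_twist_of_surj W p hp5 V (pStar_ne_zero p) C hC hsurj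
  have hord : IsOrdinaryAt V p :=
    isOrdinaryAt_of_goodOrd_or_mult_of_model_twist W V (pStar_ne_zero p) ⟨C, hC⟩ hj (Or.inl hV)
  obtain ⟨h0, hfull, hn, hlt⟩ := hcert V C hC hord Dm.f Dm.isNewformOf ϖ hϖ
  have hϖ0 : ϖ ≠ 0 := by
    rintro rfl
    apply h0
    rw [Rat.cast_zero, map_zero, zero_mul, map_zero]
  have hB0 : (if Even (p / 2) then padicLFunctionBranch Dm.f ((unitRoot V p : ℤ_[p]) : ℚ_[p]) (p / 2)
      else padicLFunctionMinusBranch Dm.f ((unitRoot V p : ℤ_[p]) : ℚ_[p]) (p / 2)) ≠ 0 := by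
    intro e; apply h0; rw [e, mul_zero, map_zero]
  obtain ⟨κ₀, γ₀, hκ₀, hγ₀, hγ₀', D₀, fE₀, hchar₀⟩ := exists_cyclotomic_dualData_generator W p
  have key : ∀ (κ : ZpExtension ℚ p) (γ : Field.absoluteGaloisGroup ℚ),
      κ.IsCyclotomic → κ.IsTopGenerator γ → IsCyclotomicVariable p γ →
      ∀ (D : W.SelmerDualData κ γ) (fE : IwasawaAlgebra p), D.charIdeal = Ideal.span {fE} →
        D.IsTorsion ∧ mu fE = 0 ∧ lam fE = n ∧ Nat.card (AddCommGroup.primaryComponent W.sha p) = 1 ∧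
          ∃ (g₁ : IwasawaAlgebra p) (u : ℤ_[p]ˣ),
          D.charIdeal = Ideal.span {g₁} ∧ iwasawaToPowerSeries p g₁ =
            PowerSeries.C (((u : ℤ_[p]) : ℚ_[p]) * (ϖ : ℚ_[p])) *
              (if Even (p / 2) then padicLFunctionBranch Dm.f ((unitRoot V p : ℤ_[p]) : ℚ_[p]) (p / 2)
                else padicLFunctionMinusBranch Dm.f ((unitRoot V p : ℤ_[p]) : ℚ_[p]) (p / 2)) := by
    intro κ γ hκ hγ hγ' D fE hchar
    haveI : Module.Finite (IwasawaAlgebra p) D.X :=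
      SelmerDualData.module_finite_of_isCyclotomic (W := W) (κ := κ) hκ D hγ
    obtain ⟨hXt, g, hg, u, hι⟩ := isTorsion_and_exists_iota_eq_branch_of_katoComponent W p
      (Kato2004.charIdeal_dvd_padicLFunctionBranch_component_of_surjective_of_half hK) hj hp2 V
      ⟨C, hC⟩ (Or.inl hV) hsurjV hκ hγ hγ' Dm.isNewformOf D ϖ hϖ
    have hn' := hn
    rw [← norm_coeff_C_unit_mul u] at hn'
    have h0' := h0
    have hfull' := hfull
    rw [← PowerSeries.coeff_zero_eq_constantCoeff_apply] at h0' hfull'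
    rw [← valuation_coeff_C_unit_mul u _ _ 0 h0'] at hfull'
    have hX0 : PowerSeries.coeff 0 (PowerSeries.C (((u : ℤ_[p]) : ℚ_[p]) * (ϖ : ℚ_[p])) *
        (if Even (p / 2) then padicLFunctionBranch Dm.f ((unitRoot V p : ℤ_[p]) : ℚ_[p]) (p / 2)
          else padicLFunctionMinusBranch Dm.f ((unitRoot V p : ℤ_[p]) : ℚ_[p]) (p / 2))) ≠ 0 := by
      rw [PowerSeries.coeff_C_mul, mul_assoc]
      rw [PowerSeries.coeff_C_mul] at h0'
      exact mul_ne_zero (PadicInt.coe_ne_zero.mpr u.ne_zero) h0'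
    rw [PowerSeries.coeff_zero_eq_constantCoeff_apply] at hX0 hfull'
    obtain ⟨hμ, hlam, hcard, -, hspan⟩ := fullSqueeze_rankZero_of_iota_eq_of_firstUnit hp2 hr0 hBcl
      hκ hγ hγ' D hXt hchar hg hι hn' (fun i hi ↦ by rw [norm_coeff_C_unit_mul u]; exact hlt i hi)
      hX0 hfull'
    exact ⟨hXt, hμ, hlam, hcard, g, u, hspan, hι⟩
  obtain ⟨-, -, -, hcard₀, -⟩ := key κ₀ γ₀ hκ₀ hγ₀ hγ₀' D₀ fE₀ hchar₀
  refine ⟨?_, hcard₀, fun κ γ hκ hγ hγ' D fE hchar ↦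
    ⟨(key κ γ hκ hγ hγ' D fE hchar).2.1, (key κ γ hκ hγ hγ' D fE hchar).2.2.1⟩⟩
  intro κ γ N _ f ε α B _ haddv _ hκ hγ hcv hf _ hα hB D
  haveI : (Literature.NumberTheory.EllipticCurves.Module.charIdeal (IwasawaAlgebra p) D.X).IsPrincipal :=
    charIdeal_isPrincipal_holds p D.X
  obtain ⟨fE, hchar⟩ := Submodule.IsPrincipal.principal
    (Literature.NumberTheory.EllipticCurves.Module.charIdeal (IwasawaAlgebra p) D.X)
  obtain ⟨hXt, -, -, -, g₁, u, hspan, hι⟩ := key κ γ hκ hγ hcv D fE hchar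
  have hnd : ∃ s : ℚ, ratPlusSymbol f s ≠ 0 := by
    refine ⟨0, fun h00 ↦ hL ?_⟩
    rw [hf.entireLFunction_one_eq, h00]
    simp
  exact ⟨hXt, exists_charIdeal_eq_span_and_iota_eq_of_generator hp2 V C hC haddv hV hf hnd Dm hϖ0
    hspan hι hB0 hα hB⟩

end ClassLevel

end Summit.BirchSwinnertonDyer.Rank1Residual.Additive

end
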